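import Literature.NumberTheory.EllipticCurves.RankinSelbergEulerProductHeckeProofs
import Literature.NumberTheory.EllipticCurves.RankinSelbergLFunctionK
import Literature.NumberTheory.EllipticCurves.LFunctionCoefficientBound
import HarnessLib

/-!
# Absolute convergence of the Rankin–Selberg Euler product `L(f ⊗ K, χ, s) = ∏_v (…)⁻¹`
# (Galois currency) for `re s > 3/2`, when `f` is the newform of an elliptic curve

Topic `Literature/NumberTheory/EllipticCurves`; THEOREMS ONLY (no definition, no named fact).
Companion of `RankinSelbergLFunctionK.lean`, where the tree DEFINES
`rankinSelbergEulerProduct f χ s := ∏' v, (rankinSelbergLocalFactorInv f χ v s)⁻¹` over the finite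
places `v` of `K` for a continuous character `χ : Γ_K → ℂˣ` (local factor
`1 − (α_ℓ^k + β_ℓ^k) w N(v)⁻ˢ + (α_ℓβ_ℓ)^k w² N(v)⁻²ˢ`, `N(v) = ℓ^k`, `w = heckeValueAt χ v`; Nekovář
1995 (0.5)/§3.4) and states in its docstring that the product is "absolutely convergent for
`re s > 3/2` (Ramanujan bound `|α_ℓ| = |β_ℓ| = √ℓ`)". Here that convergence is PROVED on the
printed half plane `re s > 3/2` whenever the Hecke eigenvalues of `f` at the primes are those of an
elliptic curve `E/ℚ` (`cuspCoeff f p = a_p(E)`; e.g. `IsNewformOf E f`) and the character values are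
bounded by `1` (`‖heckeValueAt χ v‖ ≤ 1`, e.g. every character of finite order; for Gross's rational
characters the values are `0, ±1`):

* `hasProd_rankinSelbergEulerProduct_of_cuspCoeff_eq` / `multipliable_rankinSelbergLocalFactorInv_inv`
  — `HasProd (v ↦ (rankinSelbergLocalFactorInv f χ v s)⁻¹) (rankinSelbergEulerProduct f χ s)`.

The Hecke-currency twin (`RankinSelbergEulerProductHeckeProofs.lean`, for an arbitrary cusp form,
Hecke's bound `a_n = O(n)`) reaches `re s > 2` only; the gain here is Hasse's theorem
`|a_p(E)| ≤ 2√p` (tree `WeierstrassCurve.abs_LFunction_prime_pow_le`, unconditional over `ℚ`),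
which bounds the Newton power sums `α^k + β^k` by `2 (√ℓ)^k = 2 √N(v)` at a good prime
(`norm_frobTracePow_le_of_sq_le`: the reciprocal roots have absolute value `√ℓ`) and by
`(2√ℓ)^k + 1` at a bad one (`αβ = 0`), whence `‖1 − F_v(s)‖ ≤ B · N(v)^{1/2 − re s}` and
`∑_v N(v)^{1/2 − re s} < ∞` for `re s > 3/2` (Neukirch VII (5.2), tree
`Literature.NumberTheory.LFunctions.summable_norm_absNorm_cpow`), then
`multipliable_inv_one_sub_of_summable_norm`.

Written for the discharge of Gross 2004's `L(f, χ, s) = L(A₁, s) L(A₂, s)`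
(`Gross2004/RationalCharacterLSeriesHolds.lean`), whose typed form lives on `re s > 3/2`.

## References

* [Nekovar1995] J. Nekovář, *On the p-adic height of Heegner cycles*, Math. Ann. 302 (1995), (0.5)
  p. 611 and §3.4.
* [NeukirchANT1999] J. Neukirch, *Algebraic Number Theory* (1999), Ch. VII (5.2) and (8.1).
* [SilvermanAEC2009] J. H. Silverman, *The Arithmetic of Elliptic Curves*, 2nd ed., Thm. V.1.1
  (Hasse) and §C.16.
-/

noncomputable section

open scoped MatrixGroups ModularForm Topology
open CongruenceSubgroup NumberField IsDedekindDomain Complex Filter Field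
open Literature.NumberTheory.GaloisRepresentations
open Literature.NumberTheory.EllipticCurves.ModularForms

namespace Literature.NumberTheory.EllipticCurves

universe u

variable {K : Type u} [Field K] [NumberField K] {N : ℕ}

/-! ### The Newton power sums under the Hasse bound -/

/-- **Power sums of Hasse–Weil Frobenius roots.** If `a ∈ ℤ` and `ℓ ∈ ℕ` satisfy `a² ≤ 4ℓ`
then `|α^k + β^k| ≤ 2 (√ℓ)^k` for the roots `α, β` of `X² − aX + ℓ` (which have absolute value
`√ℓ`): `‖frobTracePow a ℓ k‖ ≤ 2 (√ℓ)^k`. [cite: SilvermanAEC2009, Thm. V.1.1 and V.2.3.1 (|α| = |β| = √q)] -/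
theorem norm_frobTracePow_le_of_sq_le {a : ℤ} {ℓ : ℕ} (ha : a ^ 2 ≤ 4 * (ℓ : ℤ)) (k : ℕ) :
    ‖frobTracePow (a : ℂ) (ℓ : ℂ) k‖ ≤ 2 * Real.sqrt ℓ ^ k := by
  -- the two complex roots of `z² - a z + ℓ`
  set σ : ℝ := Real.sqrt (4 * ℓ - a ^ 2) with hσ
  have hσ2 : σ * σ = 4 * ℓ - a ^ 2 :=
    Real.mul_self_sqrt (by exact_mod_cast sub_nonneg.mpr ha)
  set α : ℂ := ⟨a / 2, σ / 2⟩ with hα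
  set β : ℂ := ⟨a / 2, -(σ / 2)⟩ with hβ
  have hsum : α + β = (a : ℂ) := Complex.ext (by simp [hα, hβ]) (by simp [hα, hβ])
  have hprod : α * β = (ℓ : ℂ) := by
    refine Complex.ext ?_ ?_
    · simp only [Complex.mul_re, hα, hβ, Complex.natCast_re]
      nlinarith [hσ2]
    · simp only [Complex.mul_im, hα, hβ, Complex.natCast_im]
      ring
  have hnorm : ∀ z : ℂ, z.re = a / 2 → z.im * z.im = σ / 2 * (σ / 2) → ‖z‖ = Real.sqrt ℓ := by
    intro z hre him
    rw [Complex.norm_def, Complex.normSq_apply]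
    congr 1
    rw [hre, him]
    nlinarith [hσ2]
  have hnα : ‖α‖ = Real.sqrt ℓ := hnorm α rfl rfl
  have hnβ : ‖β‖ = Real.sqrt ℓ := hnorm β rfl (by simp [hβ])
  have hcast : ((a : ℤ) : ℂ) = (a : ℂ) := rfl
  rw [frobTracePow_eq_pow_add_pow hsum hprod k]
  calc ‖α ^ k + β ^ k‖ ≤ ‖α‖ ^ k + ‖β‖ ^ k := by
        refine (norm_add_le _ _).trans ?_; rw [norm_pow, norm_pow]
    _ = 2 * Real.sqrt ℓ ^ k := by rw [hnα, hnβ]; ring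

/-- **Power sums with `αβ = 0`**: `frobTracePow a 0 k = a^k + 0^k`, so
`‖frobTracePow a 0 k‖ ≤ ‖a‖^k + 1`. [folklore] -/
private theorem norm_frobTracePow_zero_le (a : ℂ) (k : ℕ) : ‖frobTracePow a 0 k‖ ≤ ‖a‖ ^ k + 1 := by
  rw [frobTracePow_eq_pow_add_pow (α := a) (β := 0) (add_zero a) (mul_zero a) k]
  refine (norm_add_le _ _).trans (add_le_add (by rw [norm_pow]) ?_)
  rcases Nat.eq_zero_or_pos k with rfl | hk
  · simp
  · rw [zero_pow hk.ne', norm_zero]; exact zero_le_one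

/-! ### The local factors: `F_v = 1 − x_v` with `‖x_v‖ ≤ B · N(v)^{1/2 − re s}` -/

/-- Unfolding of the Galois-currency local factor in the notation of the definition (`q = N(v)`,
`ℓ = q.minFac`, `k = q.factorization ℓ`, `e = ℓ 𝟙_{ℓ∤N}`, `w = heckeValueAt χ v`).
[cite: Nekovar1995, (0.5) p. 611 and §3.4] -/
private theorem rankinSelbergLocalFactorInv_eq_one_sub' (f : CuspForm (Gamma0 N) 2)
    (χ : absoluteGaloisGroup K →ₜ* ℂˣ) (v : HeightOneSpectrum (𝓞 K)) (s : ℂ) :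
    rankinSelbergLocalFactorInv f χ v s = 1 -
      (frobTracePow (cuspCoeff f (Ideal.absNorm v.asIdeal).minFac)
          (if (Ideal.absNorm v.asIdeal).minFac ∣ N then 0 else ((Ideal.absNorm v.asIdeal).minFac : ℂ))
          ((Ideal.absNorm v.asIdeal).factorization (Ideal.absNorm v.asIdeal).minFac) *
        heckeValueAt χ v * ((Ideal.absNorm v.asIdeal : ℕ) : ℂ) ^ (-s) -
      (if (Ideal.absNorm v.asIdeal).minFac ∣ N then 0 else ((Ideal.absNorm v.asIdeal).minFac : ℂ)) ^
          ((Ideal.absNorm v.asIdeal).factorization (Ideal.absNorm v.asIdeal).minFac) *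
        heckeValueAt χ v ^ 2 * ((Ideal.absNorm v.asIdeal : ℕ) : ℂ) ^ (-2 * s)) := by
  rw [rankinSelbergLocalFactorInv]
  ring

/-- **Uniform Ramanujan-type bound on the deviation of the local factors.** Let `f ∈ S₂(Γ₀(N))`
have the Hecke eigenvalues of an elliptic curve `E/ℚ` at the primes (`cuspCoeff f p = a_p(E)`),
`χ` a continuous character of `Γ_K` with `‖heckeValueAt χ v‖ ≤ 1`, and `re s ≥ 1/2`. Then for
some `B` independent of `v`: `‖1 − rankinSelbergLocalFactorInv f χ v s‖ ≤ B · N(v)^{1/2 − re s}`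
for every finite place `v` (Hasse `|a_ℓ| ≤ 2√ℓ`, `|α^k + β^k| ≤ 2√N(v)` at good `ℓ`,
`≤ (2^k + 1) √N(v)` at bad `ℓ`, `k ≤ [K:ℚ]`). [cite: NeukirchANT1999, Ch. VII §8 proof of (8.1)]
[cite: SilvermanAEC2009, Thm. V.1.1] -/
theorem exists_norm_one_sub_rankinSelbergLocalFactorInv_le (f : CuspForm (Gamma0 N) 2)
    (W : WeierstrassCurve ℚ) [W.IsElliptic]
    (hf : ∀ p : ℕ, p.Prime → cuspCoeff f p = (W.LFunction p : ℂ))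
    (χ : absoluteGaloisGroup K →ₜ* ℂˣ) (hχ : ∀ v : HeightOneSpectrum (𝓞 K), ‖heckeValueAt χ v‖ ≤ 1)
    {s : ℂ} (hs : 1 / 2 ≤ s.re) :
    ∃ B : ℝ, 0 ≤ B ∧ ∀ v : HeightOneSpectrum (𝓞 K),
      ‖1 - rankinSelbergLocalFactorInv f χ v s‖ ≤
        B * ‖((Ideal.absNorm v.asIdeal : ℕ) : ℂ) ^ (-(s - 1 / 2))‖ := by
  set d := Module.finrank ℚ K with hd
  refine ⟨(2 : ℝ) ^ d + 2, by positivity, fun v ↦ ?_⟩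
  obtain ⟨k, hk0, hkd, hℓ, hqk, hfac⟩ := absNorm_heightOneSpectrum_eq_pow v
  rw [rankinSelbergLocalFactorInv_eq_one_sub', sub_sub_cancel, hfac]
  set q : ℕ := Ideal.absNorm v.asIdeal with hqdef
  set ℓ : ℕ := q.minFac with hℓdef
  set w : ℂ := heckeValueAt χ v with hwdef
  set e : ℂ := (if ℓ ∣ N then 0 else (ℓ : ℂ)) with hedef
  have hq0 : 0 < q := by rw [hqk]; exact pow_pos hℓ.pos k
  have hq1 : (1 : ℝ) ≤ q := by exact_mod_cast hq0
  have hℓ1 : (1 : ℝ) ≤ ℓ := by exact_mod_cast hℓ.one_lt.le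
  have hqR : (q : ℝ) = (ℓ : ℝ) ^ k := by exact_mod_cast hqk
  have hsqrt : Real.sqrt q = Real.sqrt ℓ ^ k := by
    rw [hqR, show ((ℓ : ℝ)) ^ k = (Real.sqrt ℓ ^ k) ^ 2 by
      rw [← pow_mul, mul_comm, pow_mul, Real.sq_sqrt (by positivity)],
      Real.sqrt_sq (by positivity)]
  have hsqrt1 : (1 : ℝ) ≤ Real.sqrt q := by
    rw [show (1 : ℝ) = Real.sqrt 1 by simp]; exact Real.sqrt_le_sqrt hq1
  -- norms of the powers of `N(v)`
  have hns : ‖((q : ℕ) : ℂ) ^ (-s)‖ = (q : ℝ) ^ (-s.re) := by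
    rw [Complex.norm_natCast_cpow_of_pos hq0, Complex.neg_re]
  have hn2s : ‖((q : ℕ) : ℂ) ^ (-2 * s)‖ = (q : ℝ) ^ (-2 * s.re) := by
    rw [Complex.norm_natCast_cpow_of_pos hq0]
    congr 1
    simp
  have hns1 : ‖((q : ℕ) : ℂ) ^ (-(s - 1 / 2))‖ = (q : ℝ) ^ (1 / 2 - s.re) := by
    rw [Complex.norm_natCast_cpow_of_pos hq0]
    congr 1
    simp
  have hhalf : Real.sqrt q = (q : ℝ) ^ (1 / 2 : ℝ) := Real.sqrt_eq_rpow q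
  have hq12 : Real.sqrt q * (q : ℝ) ^ (-s.re) = (q : ℝ) ^ (1 / 2 - s.re) := by
    rw [hhalf, sub_eq_add_neg, Real.rpow_add (by positivity)]
  have h2le : (q : ℝ) * (q : ℝ) ^ (-2 * s.re) ≤ (q : ℝ) ^ (1 / 2 - s.re) := by
    rw [show (q : ℝ) * (q : ℝ) ^ (-2 * s.re) = (q : ℝ) ^ (1 + (-2 * s.re)) by
      rw [Real.rpow_add (by positivity), Real.rpow_one]]
    exact Real.rpow_le_rpow_of_exponent_le hq1 (by linarith)
  -- Hasse: `|a_ℓ| ≤ 2√ℓ`, `a_ℓ² ≤ 4ℓ`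
  have ha : cuspCoeff f ℓ = (W.LFunction ℓ : ℂ) := hf ℓ hℓ
  have hW : |(W.LFunction ℓ : ℝ)| ≤ 2 * Real.sqrt ℓ := by
    have h := W.abs_LFunction_prime_pow_le hℓ 1
    norm_num at h
    exact h
  have hHasse : (W.LFunction ℓ) ^ 2 ≤ 4 * (ℓ : ℤ) := by
    have h2 : (W.LFunction ℓ : ℝ) ^ 2 ≤ (2 * Real.sqrt ℓ) ^ 2 := by
      rw [← sq_abs]
      exact pow_le_pow_left₀ (abs_nonneg _) hW 2
    rw [mul_pow, Real.sq_sqrt (by positivity)] at h2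
    have h3 : ((W.LFunction ℓ ^ 2 : ℤ) : ℝ) ≤ ((4 * (ℓ : ℤ) : ℤ) : ℝ) := by push_cast; linarith
    exact_mod_cast h3
  -- the pieces
  have hw : ‖w‖ ≤ 1 := hχ v
  have hw2 : ‖w ^ 2‖ ≤ 1 := by rw [norm_pow]; exact pow_le_one₀ (norm_nonneg _) hw
  have ht : ‖frobTracePow (cuspCoeff f ℓ) e k‖ ≤ (2 ^ d + 1) * Real.sqrt q := by
    rw [ha, hedef]
    split_ifs with hℓN
    · -- bad prime: `αβ = 0`
      refine (norm_frobTracePow_zero_le _ k).trans ?_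
      have h1 : ‖((W.LFunction ℓ : ℤ) : ℂ)‖ ≤ 2 * Real.sqrt ℓ := by
        rw [Complex.norm_intCast]; exact hW
      have h2 : ‖((W.LFunction ℓ : ℤ) : ℂ)‖ ^ k ≤ (2 * Real.sqrt ℓ) ^ k :=
        pow_le_pow_left₀ (norm_nonneg _) h1 k
      rw [mul_pow, ← hsqrt] at h2
      have h3 : (2 : ℝ) ^ k ≤ 2 ^ d := pow_le_pow_right₀ (by norm_num) hkd
      nlinarith [h3, Real.sqrt_nonneg (q : ℝ), hsqrt1]
    · -- good prime: reciprocal roots of absolute value `√ℓ`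
      refine (norm_frobTracePow_le_of_sq_le hHasse k).trans ?_
      rw [← hsqrt]
      have h3 : (2 : ℝ) ≤ 2 ^ d + 1 := by
        have : (1 : ℝ) ≤ 2 ^ d := one_le_pow₀ (by norm_num)
        linarith
      exact mul_le_mul_of_nonneg_right h3 (Real.sqrt_nonneg _)
  have he : ‖e‖ ≤ ℓ := by
    rw [hedef]
    split_ifs
    · rw [norm_zero]; positivity
    · rw [Complex.norm_natCast]
  have hek : ‖e ^ k‖ ≤ q := by
    rw [norm_pow, hqR]
    exact pow_le_pow_left₀ (norm_nonneg _) he k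
  -- assemble
  have hX : ‖frobTracePow (cuspCoeff f ℓ) e k * w * ((q : ℕ) : ℂ) ^ (-s)‖ ≤
      (2 ^ d + 1) * Real.sqrt q * (q : ℝ) ^ (-s.re) := by
    rw [norm_mul, norm_mul, hns]
    have := mul_le_mul ht hw (norm_nonneg _) (by positivity)
    rw [mul_one] at this
    exact mul_le_mul_of_nonneg_right this (by positivity)
  have hY : ‖e ^ k * w ^ 2 * ((q : ℕ) : ℂ) ^ (-2 * s)‖ ≤ q * (q : ℝ) ^ (-2 * s.re) := by
    rw [norm_mul, norm_mul, hn2s]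
    have := mul_le_mul hek hw2 (norm_nonneg _) (by positivity)
    rw [mul_one] at this
    exact mul_le_mul_of_nonneg_right this (by positivity)
  calc ‖frobTracePow (cuspCoeff f ℓ) e k * w * ((q : ℕ) : ℂ) ^ (-s) -
          e ^ k * w ^ 2 * ((q : ℕ) : ℂ) ^ (-2 * s)‖
      ≤ (2 ^ d + 1) * Real.sqrt q * (q : ℝ) ^ (-s.re) + q * (q : ℝ) ^ (-2 * s.re) :=
        (norm_sub_le _ _).trans (add_le_add hX hY)
    _ ≤ (2 ^ d + 1) * (q : ℝ) ^ (1 / 2 - s.re) + (q : ℝ) ^ (1 / 2 - s.re) := by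
        rw [mul_assoc, hq12]; exact add_le_add le_rfl h2le
    _ = (2 ^ d + 2) * (q : ℝ) ^ (1 / 2 - s.re) := by ring
    _ = (2 ^ d + 2) * ‖((q : ℕ) : ℂ) ^ (-(s - 1 / 2))‖ := by rw [hns1]

/-- **`∑_v ‖1 − F_v(s)‖ < ∞` for `re s > 3/2`** under the hypotheses of the previous theorem: by
the uniform bound `‖1 − F_v‖ ≤ B N(v)^{1/2 − re s}` and the absolute convergence of
`∑_𝔞 N(𝔞)^{-(s − 1/2)}` for `re (s − 1/2) > 1` (Neukirch VII (5.2)).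
[cite: NeukirchANT1999, Ch. VII §5 (5.2) Proposition and §8 (8.1)] -/
theorem summable_norm_one_sub_rankinSelbergLocalFactorInv (f : CuspForm (Gamma0 N) 2)
    (W : WeierstrassCurve ℚ) [W.IsElliptic]
    (hf : ∀ p : ℕ, p.Prime → cuspCoeff f p = (W.LFunction p : ℂ))
    (χ : absoluteGaloisGroup K →ₜ* ℂˣ) (hχ : ∀ v : HeightOneSpectrum (𝓞 K), ‖heckeValueAt χ v‖ ≤ 1)
    {s : ℂ} (hs : (3 / 2 : ℝ) < s.re) :
    Summable fun v : HeightOneSpectrum (𝓞 K) ↦ ‖1 - rankinSelbergLocalFactorInv f χ v s‖ := by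
  obtain ⟨B, hB0, hB⟩ := exists_norm_one_sub_rankinSelbergLocalFactorInv_le f W hf χ hχ
    (show 1 / 2 ≤ s.re by linarith)
  have hs1 : 1 < (s - 1 / 2).re := by
    simp
    linarith
  have h1 : Summable fun I : Ideal (𝓞 K) ↦ ‖((Ideal.absNorm I : ℕ) : ℂ) ^ (-(s - 1 / 2))‖ :=
    Literature.NumberTheory.LFunctions.summable_norm_absNorm_cpow (K := K) hs1
  have h2 : Summable fun v : HeightOneSpectrum (𝓞 K) ↦
      B * ‖((Ideal.absNorm v.asIdeal : ℕ) : ℂ) ^ (-(s - 1 / 2))‖ :=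
    (h1.comp_injective (fun v w h ↦ HeightOneSpectrum.ext h)).mul_left B
  exact Summable.of_nonneg_of_le (fun v ↦ norm_nonneg _) hB h2

/-- **The Rankin–Selberg Euler product (Galois currency) is multipliable for `re s > 3/2`** when
`f` has the prime Hecke eigenvalues of an elliptic curve `E/ℚ` and `‖heckeValueAt χ v‖ ≤ 1`.
[cite: Nekovar1995, (0.5) p. 611 and §3.4] [cite: NeukirchANT1999, Ch. VII §8 (8.1)] -/
theorem multipliable_rankinSelbergLocalFactorInv_inv (f : CuspForm (Gamma0 N) 2)
    (W : WeierstrassCurve ℚ) [W.IsElliptic]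
    (hf : ∀ p : ℕ, p.Prime → cuspCoeff f p = (W.LFunction p : ℂ))
    (χ : absoluteGaloisGroup K →ₜ* ℂˣ) (hχ : ∀ v : HeightOneSpectrum (𝓞 K), ‖heckeValueAt χ v‖ ≤ 1)
    {s : ℂ} (hs : (3 / 2 : ℝ) < s.re) :
    Multipliable fun v : HeightOneSpectrum (𝓞 K) ↦ (rankinSelbergLocalFactorInv f χ v s)⁻¹ := by
  have h := multipliable_inv_one_sub_of_summable_norm
    (summable_norm_one_sub_rankinSelbergLocalFactorInv f W hf χ hχ hs)
  refine h.congr fun v ↦ ?_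
  rw [sub_sub_cancel]

/-- **`L(f ⊗ K, χ, s) = ∏_v (…)⁻¹` as a convergent product on the printed half plane
`re s > 3/2`** (`HasProd` over the finite places of `K`), for `f` with the prime Hecke eigenvalues
of an elliptic curve `E/ℚ` (e.g. `IsNewformOf E f`) and a continuous character `χ` of `Γ_K` with
`‖heckeValueAt χ v‖ ≤ 1`: the tree's `rankinSelbergEulerProduct f χ s` (defined as the `tprod`) is
the value of the unconditionally convergent Euler product. [cite: Nekovar1995, (0.5) p. 611 and §3.4] -/
theorem hasProd_rankinSelbergEulerProduct_of_cuspCoeff_eq (f : CuspForm (Gamma0 N) 2)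
    (W : WeierstrassCurve ℚ) [W.IsElliptic]
    (hf : ∀ p : ℕ, p.Prime → cuspCoeff f p = (W.LFunction p : ℂ))
    (χ : absoluteGaloisGroup K →ₜ* ℂˣ) (hχ : ∀ v : HeightOneSpectrum (𝓞 K), ‖heckeValueAt χ v‖ ≤ 1)
    {s : ℂ} (hs : (3 / 2 : ℝ) < s.re) :
    HasProd (fun v : HeightOneSpectrum (𝓞 K) ↦ (rankinSelbergLocalFactorInv f χ v s)⁻¹)
      (rankinSelbergEulerProduct f χ s) :=
  (multipliable_rankinSelbergLocalFactorInv_inv f W hf χ hχ hs).hasProd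

end Literature.NumberTheory.EllipticCurves

end
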